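import Mathlib
import HarnessLib
import Literature.MathematicalPhysics.QuantumLattice.GrassmannEffectiveActionBound
import Summits.HubbardSuperconductivity.HubbardSuperconductivity.Theorems.KLProgrammeKLRegimeEngineTowerScaling

/-!
# Route `KLProgramme` — crux K3 ENGINE (stmt-HubbardSuperconductivity-20437 `KLRegimeEngineV17F2`), stub (b) v2, THE LEVELS PACKAGE (ℓ):
# (I1-dim), first brick — the (Hstep) doors' graded right side is dominated by the kit's step right side (E1-LEVELS-BLUEPRINT-g8 §9; E1 lead r2d-p2 g8)

The E1 plateau doors (`Literature/…/SectorisedIncrementBound*Plateau`, at the block geometry: `…EngineTowerBlockStep{Wt,Lev}`) bound a born increment of degree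
`m + 1 = 2p` by `cr·cc^m·[Σ_{n∈Ico 2 N₀} ρ^{-(m+1)} κ^{-2(n−1)} α^{n−1} eⁿ · Σ_{δ∈[0,D_Γ]^n, m+1+2(n−1) ≤ Σ2δ} Π_a (e²(κ+ρ))^{2δ_a} N(δ_a) + tail(normV)]`; the kit's
induction `towerBorn_le_law_split` (part 9) consumes `Σ_{n∈Icc 2 N} e·Φ^{n−1}·ψ^p·towerS D τ μ n p + ψ^p·e·towerV D τ μ·(Φ·towerV)^N/(1−Φ·towerV)` (…TowerProfiles).
This file is the pure-algebra DICTIONARY of blueprint §9: `N := N₀ − 1`, `ψ := ρ⁻²`, `Φ := eα/κ²`, `τ := (e²(κ+ρ))²`, `μ := N` (`N 0 = 0`), any `D ≥ D_Γ`: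

* `door_coef_eq` — `ρ^{-(2p)}·κ^{-2k}·(α^k·e^{k+1}) = e·(eα/κ²)^k·(ρ⁻²)^p`;
* `normV_le_towerV` — `normV Γ κ ρ N ≤ towerV D τ N` (drop `N 0 = 0`, enlarge the range, `τ^{m} ≤ (eτ)^{m}`);
* `geomTail_mono` — `V ↦ e·V·(ΦV)^N/(1−ΦV)` is monotone on `[0, 1/Φ)`;
* **`doorGraded_le_kitStep`** — the door's bracket (graded sum + tail) `≤` the kit's (graded sum + tail) under the kit's guard `Φ·towerV < 1`; the graded terms are EQUAL
  order by order (`sum_range_filter_prod_eq_towerS`), only the tail loses one `e` per degree.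
Pure real analysis; nothing about the model is asserted.
-/

noncomputable section

namespace Summit.HubbardSuperconductivity.HubbardSuperconductivity.Theorems.EngineV8

set_option linter.dupNamespace false -- summit = problem name (single-conjunct summit), D-0017

open Real Finset Literature.MathematicalPhysics.QuantumLattice

/-- **The door's order-`n` prefactor in kit form**: `ρ^{-(2p)}·κ^{-2k}·(α^k·e^{k+1}) = e·(eα/κ²)^k·(ρ⁻²)^p` (`k = n − 1`). -/
theorem door_coef_eq {κ ρ : ℝ} (hκ : κ ≠ 0) (α : ℝ) (p k : ℕ) :
    ρ⁻¹ ^ (2 * p) * κ⁻¹ ^ (2 * k) * (α ^ k * exp ((k + 1 : ℕ) : ℝ)) = exp 1 * (exp 1 * α / κ ^ 2) ^ k * (ρ⁻¹ ^ 2) ^ p := by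
  have hκ2 : κ ^ (2 * k) ≠ 0 := pow_ne_zero _ hκ
  rw [← Real.exp_one_pow, pow_succ, div_pow, mul_pow, ← pow_mul, ← pow_mul, inv_pow, inv_pow]
  field_simp

/-- **`normV ≤ towerV` in the dictionary** (`N 0 = 0`, `N ≥ 0`, `D ≥ |Γ|/2`, `τ := (e²(κ+ρ))²`): `Σ_{m≤|Γ|/2} (e²(κ+ρ))^{2m} N(m) ≤ Σ_{m∈[1,D]} (e·τ)^m N(m)`. -/
theorem normV_le_towerV {Γ : Type*} [Fintype Γ] {κ ρ : ℝ} (hκ : 0 ≤ κ) (hρ : 0 ≤ ρ) {N : ℕ → ℝ} (hN0 : ∀ m, 0 ≤ N m) (hN00 : N 0 = 0)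
    {D : ℕ} (hD : Fintype.card Γ / 2 ≤ D) :
    normV Γ κ ρ N ≤ towerV D ((exp 2 * (κ + ρ)) ^ 2) N := by
  rw [normV, towerV]
  have hτ : 0 ≤ exp 2 * (κ + ρ) := mul_nonneg (exp_pos _).le (add_nonneg hκ hρ)
  calc ∑ m' ∈ range (Fintype.card Γ / 2 + 1), (exp 2 * (κ + ρ)) ^ (2 * m') * N m'
      = ∑ m' ∈ range (Fintype.card Γ / 2 + 1), ((exp 2 * (κ + ρ)) ^ 2) ^ m' * N m' := by
        refine sum_congr rfl fun m' _ => ?_; rw [pow_mul]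
    _ = ∑ m' ∈ Icc 1 (Fintype.card Γ / 2), ((exp 2 * (κ + ρ)) ^ 2) ^ m' * N m' := sum_range_eq_sum_Icc_of_zero hN00
    _ ≤ ∑ m' ∈ Icc 1 D, ((exp 2 * (κ + ρ)) ^ 2) ^ m' * N m' :=
        sum_le_sum_of_subset_of_nonneg (Icc_subset_Icc le_rfl hD) fun m' _ _ => mul_nonneg (pow_nonneg (pow_nonneg hτ _) _) (hN0 m')
    _ ≤ ∑ m' ∈ Icc 1 D, (exp 1 * (exp 2 * (κ + ρ)) ^ 2) ^ m' * N m' := by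
        refine sum_le_sum fun m' _ => mul_le_mul_of_nonneg_right (pow_le_pow_left₀ (pow_nonneg hτ _) ?_ _) (hN0 m')
        have h1 : (1 : ℝ) ≤ exp 1 := Real.one_le_exp (by norm_num)
        have := pow_nonneg hτ 2
        nlinarith

/-- **The geometric tail is monotone in `V`** on `[0, 1/Φ)`: `0 ≤ V ≤ V′`, `Φ ≥ 0`, `Φ·V′ < 1` ⇒ `e·V·(ΦV)^N/(1−ΦV) ≤ e·V′·(ΦV′)^N/(1−ΦV′)`. -/
theorem geomTail_mono {Φ V V' : ℝ} (hΦ : 0 ≤ Φ) (hV : 0 ≤ V) (hVV : V ≤ V') (hguard : Φ * V' < 1) (N : ℕ) :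
    exp 1 * V * (Φ * V) ^ N / (1 - Φ * V) ≤ exp 1 * V' * (Φ * V') ^ N / (1 - Φ * V') := by
  have hV' : 0 ≤ V' := hV.trans hVV
  have hΦV : Φ * V ≤ Φ * V' := mul_le_mul_of_nonneg_left hVV hΦ
  have h1 : 0 < 1 - Φ * V' := sub_pos.2 hguard
  have h1' : 0 < 1 - Φ * V := lt_of_lt_of_le h1 (by linarith)
  have hnum : exp 1 * V * (Φ * V) ^ N ≤ exp 1 * V' * (Φ * V') ^ N :=
    mul_le_mul (mul_le_mul_of_nonneg_left hVV (exp_pos _).le) (pow_le_pow_left₀ (mul_nonneg hΦ hV) hΦV N)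
      (pow_nonneg (mul_nonneg hΦ hV) _) (mul_nonneg (exp_pos _).le hV')
  exact div_le_div₀ (mul_nonneg (mul_nonneg (exp_pos _).le hV') (pow_nonneg (mul_nonneg hΦ hV') _)) hnum h1 (by linarith)

/-- **THE DOOR'S BRACKET IS DOMINATED BY THE KIT'S STEP RIGHT SIDE.**  Data: `κ, ρ > 0`, `α ≥ 0`, sizes `N ≥ 0` with `N 0 = 0` on the label type `Γ`, a degree
bound `D ≥ |Γ|/2`, a truncation order `N₀ ≥ 2`, output degree `m + 1 = 2p`, and the kit's guard `(eα/κ²)·towerV D τ N < 1` at `τ := (e²(κ+ρ))²`.  Then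
`[door graded sum over Ico 2 N₀] + [door tail in normV] ≤ [kit graded sum over Icc 2 (N₀−1) with Φ = eα/κ², ψ = ρ⁻², towerS D τ N] + [kit tail in towerV D τ N]`. -/
theorem doorGraded_le_kitStep {Γ : Type*} [Fintype Γ] {κ ρ α : ℝ} (hκ : 0 < κ) (hρ : 0 < ρ) (hα : 0 ≤ α)
    {N : ℕ → ℝ} (hN0 : ∀ m, 0 ≤ N m) (hN00 : N 0 = 0) {D : ℕ} (hD : Fintype.card Γ / 2 ≤ D)
    {N₀ : ℕ} (hN₀ : 2 ≤ N₀) {m p : ℕ} (hmp : m + 1 = 2 * p)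
    (hguard : exp 1 * α / κ ^ 2 * towerV D ((exp 2 * (κ + ρ)) ^ 2) N < 1) :
    (∑ n ∈ Ico 2 N₀, (ρ⁻¹ ^ (m + 1) * κ⁻¹ ^ (2 * (n - 1)) * (α ^ (n - 1) * exp n)) *
        ∑ δ ∈ (Fintype.piFinset fun _ : Fin n => range (Fintype.card Γ / 2 + 1)) with m + 1 + 2 * (n - 1) ≤ ∑ a, 2 * δ a,
          ∏ a, (exp 2 * (κ + ρ)) ^ (2 * δ a) * N (δ a)) +
      ρ⁻¹ ^ (m + 1) * (exp 1 * normV Γ κ ρ N) * (exp 1 * α * normV Γ κ ρ N / κ ^ 2) ^ (N₀ - 1) /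
        (1 - exp 1 * α * normV Γ κ ρ N / κ ^ 2) ≤
    ∑ n ∈ Icc 2 (N₀ - 1), exp 1 * (exp 1 * α / κ ^ 2) ^ (n - 1) * (ρ⁻¹ ^ 2) ^ p *
        towerS D ((exp 2 * (κ + ρ)) ^ 2) N n p +
      (ρ⁻¹ ^ 2) ^ p * (exp 1 * towerV D ((exp 2 * (κ + ρ)) ^ 2) N *
        (exp 1 * α / κ ^ 2 * towerV D ((exp 2 * (κ + ρ)) ^ 2) N) ^ (N₀ - 1) /
        (1 - exp 1 * α / κ ^ 2 * towerV D ((exp 2 * (κ + ρ)) ^ 2) N)) := by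
  set τ := (exp 2 * (κ + ρ)) ^ 2 with hτ
  set Φ := exp 1 * α / κ ^ 2 with hΦ
  have hτ0 : 0 ≤ exp 2 * (κ + ρ) := mul_nonneg (exp_pos _).le (add_nonneg hκ.le hρ.le)
  have hΦ0 : 0 ≤ Φ := by rw [hΦ]; positivity
  have hIco : Ico 2 N₀ = Icc 2 (N₀ - 1) := by
    ext n; simp only [mem_Ico, mem_Icc]; omega
  refine add_le_add ?_ ?_
  · -- graded part: order by order
    rw [hIco]
    refine sum_le_sum fun n hn => ?_
    have hn1 : 1 ≤ n := by have := (mem_Icc.1 hn).1; omega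
    -- prefactor
    have hcoef : ρ⁻¹ ^ (m + 1) * κ⁻¹ ^ (2 * (n - 1)) * (α ^ (n - 1) * exp n) = exp 1 * Φ ^ (n - 1) * (ρ⁻¹ ^ 2) ^ p := by
      have h := door_coef_eq hκ.ne' (ρ := ρ) α p (n - 1)
      rw [show n - 1 + 1 = n by omega] at h
      rw [hmp, hΦ]
      exact h
    rw [hcoef]
    have hc0 : 0 ≤ exp 1 * Φ ^ (n - 1) * (ρ⁻¹ ^ 2) ^ p := by positivity
    refine mul_le_mul_of_nonneg_left ?_ hc0
    -- inner sum: enlarge the range to `[0, D]`, then it IS `towerS`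
    have hsub : ((Fintype.piFinset fun _ : Fin n => range (Fintype.card Γ / 2 + 1)).filter
          fun δ : Fin n → ℕ => m + 1 + 2 * (n - 1) ≤ ∑ a, 2 * δ a) ⊆
        ((Fintype.piFinset fun _ : Fin n => range (D + 1)).filter fun δ : Fin n → ℕ => 2 * p + 2 * (n - 1) ≤ ∑ a, 2 * δ a) := by
      intro δ hδ
      rw [mem_filter, Fintype.mem_piFinset] at hδ ⊢
      exact ⟨fun a => mem_range.2 (lt_of_lt_of_le (mem_range.1 (hδ.1 a)) (by omega)), hmp ▸ hδ.2⟩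
    calc ∑ δ ∈ (Fintype.piFinset fun _ : Fin n => range (Fintype.card Γ / 2 + 1)) with m + 1 + 2 * (n - 1) ≤ ∑ a, 2 * δ a,
          ∏ a, (exp 2 * (κ + ρ)) ^ (2 * δ a) * N (δ a)
        ≤ ∑ δ ∈ (Fintype.piFinset fun _ : Fin n => range (D + 1)) with 2 * p + 2 * (n - 1) ≤ ∑ a, 2 * δ a,
          ∏ a, (exp 2 * (κ + ρ)) ^ (2 * δ a) * N (δ a) :=
          sum_le_sum_of_subset_of_nonneg hsub fun δ _ _ => prod_nonneg fun a _ => mul_nonneg (pow_nonneg hτ0 _) (hN0 _)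
      _ = ∑ δ ∈ (Fintype.piFinset fun _ : Fin n => range (D + 1)) with 2 * p + 2 * (n - 1) ≤ ∑ a, 2 * δ a,
          ∏ a, τ ^ (δ a) * N (δ a) := by
          refine sum_congr rfl fun δ _ => prod_congr rfl fun a _ => ?_; rw [hτ, ← pow_mul]
      _ = towerS D τ N n p := sum_range_filter_prod_eq_towerS hn1 hN00 p
  · -- tail: `normV ≤ towerV`, monotone tail
    have hV := normV_le_towerV hκ.le hρ.le hN0 hN00 hD (κ := κ) (ρ := ρ)
    have hV0 : 0 ≤ normV Γ κ ρ N := normV_nonneg hκ.le hρ.le hN0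
    have hψ : 0 ≤ (ρ⁻¹ ^ 2) ^ p := by positivity
    have htail := geomTail_mono hΦ0 hV0 hV hguard (N₀ - 1)
    have hlhs : ρ⁻¹ ^ (m + 1) * (exp 1 * normV Γ κ ρ N) * (exp 1 * α * normV Γ κ ρ N / κ ^ 2) ^ (N₀ - 1) /
          (1 - exp 1 * α * normV Γ κ ρ N / κ ^ 2) =
        (ρ⁻¹ ^ 2) ^ p * (exp 1 * normV Γ κ ρ N * (Φ * normV Γ κ ρ N) ^ (N₀ - 1) / (1 - Φ * normV Γ κ ρ N)) := by
      rw [hmp, pow_mul, hΦ]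
      have : exp 1 * α * normV Γ κ ρ N / κ ^ 2 = exp 1 * α / κ ^ 2 * normV Γ κ ρ N := by ring
      rw [this]; ring
    rw [hlhs]
    exact mul_le_mul_of_nonneg_left htail hψ

end Summit.HubbardSuperconductivity.HubbardSuperconductivity.Theorems.EngineV8

end
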